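import Literature.AlgebraicGeometry.Smoothening.DefectBound
import Literature.RingTheory.FittingIdeal.ConstantRank
import Mathlib.RingTheory.Spectrum.Prime.FreeLocus
import HarnessLib

/-!
# Boundedness of Néron's measure when `Ω¹` of the generic fibre is locally free (BLR 3.3/3)

Topic: `Literature/AlgebraicGeometry/Smoothening` (Bosch–Lütkebohmert–Raynaud, *Néron Models*,
§3.3, Lemma 3: `δ` is bounded on the points of an `R`-scheme of finite type `X` with smooth
generic fibre `X_K`). `DefectBound.exists_bound_neronDefect` proves the ring form for
`X = Spec A` under the hypothesis that `Ω[A[1/ϖ]⁄R]` is *free*; an affine open of an abelian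
variety has `Ω¹` only *locally* free in general (as a module; it is free as soon as invariant
differentials are available, which we do not assume). This file proves the bound when
`A[1/ϖ]` is a domain and `Ω[A[1/ϖ]⁄R]` is finite projective (`exists_bound_neronDefect_of_projective`):
the rank of `Ω[A[1/ϖ]⁄R]` at every prime is its generic rank `d` (Mathlib
`Module.rankAtStalk_eq_of_le_of_finite_of_flat`), so `Fitt_d(Ω[A[1/ϖ]⁄R]) = A[1/ϖ]`
(`Literature.RingTheory.FittingIdeal.Module.fittingIdeal_eq_top_of_rankAtStalk_eq`, Stacks 07ZD)
and the rank of `a*Ω[A⁄R]` at every point `a` with `ϖ ≠ 0` is `d`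
(`finrank_tensor_kaehler_eq_rankAtStalk`); the rest is `DefectBound`. [folklore]; no named facts
(D-0026).

## References

* S. Bosch, W. Lütkebohmert, M. Raynaud, *Néron Models*, Springer 1990, §3.3, Lemma 3.
  [BLRNeronModels1990] (Not held; number only.)
* The Stacks Project, Tags 07ZA, 07ZD. [StacksProject]
-/

noncomputable section

open scoped TensorProduct
open Module KaehlerDifferential
open Literature.RingTheory.FittingIdeal

namespace Literature.AlgebraicGeometry.Smoothening

universe u

variable (R : Type u) [CommRing R] (ϖ : R) (A : Type u) [CommRing A] [Algebra R A]
  (A' : Type u) [CommRing A'] [Algebra A A'] [Algebra R A'] [IsScalarTower R A A']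
  [IsLocalization.Away (algebraMap R A ϖ) A']

/-- Over a domain, a finite projective module has constant rank: its Fitting ideal in the generic
rank is the unit ideal (Stacks 07ZD). [cite: StacksProject, Tag 07ZD] -/
theorem fittingIdeal_eq_top_of_projective (B : Type u) [CommRing B] [IsDomain B] (M : Type u)
    [AddCommGroup M] [Module B M] [Module.Finite B M] [Module.Projective B M] :
    Module.fittingIdeal B M (Module.rankAtStalk M (⊥ : PrimeSpectrum B)) = ⊤ :=
  Module.fittingIdeal_eq_top_of_rankAtStalk_eq fun p =>
    (Module.rankAtStalk_eq_of_le_of_finite_of_flat M (show (⊥ : PrimeSpectrum B) ≤ p from bot_le)).symm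

/-- **The generic rank of `a*Ω[A⁄R]` is the generic rank of `Ω¹` of the generic fibre**: for a
point `a : A → S` with values in a domain in which `ϖ ≠ 0`, `A[1/ϖ]` a domain and
`Ω[A[1/ϖ]⁄R]` finite projective, `rank_S (S ⊗_A Ω[A⁄R])` is the rank of `Ω[A[1/ϖ]⁄R]` at the
generic point (through the fraction field of `S`, an `A[1/ϖ]`-algebra, and constancy of the
rank). [folklore] -/
theorem finrank_tensor_kaehler_eq_rankAtStalk (S : Type u) [CommRing S] [IsDomain S] [Algebra R S]
    [Algebra A S] [IsScalarTower R A S] [IsDomain A'] [Module.Finite A' Ω[A'⁄R]]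
    [Module.Projective A' Ω[A'⁄R]] (hϖ : algebraMap R S ϖ ≠ 0) :
    finrank S (S ⊗[A] Ω[A⁄R]) = Module.rankAtStalk Ω[A'⁄R] (⊥ : PrimeSpectrum A') := by
  let K := FractionRing S
  have hunit : IsUnit (algebraMap A K (algebraMap R A ϖ)) := by
    rw [isUnit_iff_ne_zero, IsScalarTower.algebraMap_apply A S K, ← IsScalarTower.algebraMap_apply
      R A S]
    exact (map_ne_zero_iff _ (IsFractionRing.injective S K)).mpr hϖ
  letI : Algebra A' K :=
    (IsLocalization.Away.lift (algebraMap R A ϖ) hunit : A' →+* K).toAlgebra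
  haveI : IsScalarTower A A' K := IsScalarTower.of_algebraMap_eq fun a =>
    (IsLocalization.Away.lift_eq (S := A') (algebraMap R A ϖ) hunit a).symm
  have e : K ⊗[S] (S ⊗[A] Ω[A⁄R]) ≃ₗ[K] K ⊗[A'] Ω[A'⁄R] :=
    (TensorProduct.AlgebraTensorModule.cancelBaseChange A S K K Ω[A⁄R]).trans
      (tensorKaehlerEquivOfIsLocalization R A A' (Submonoid.powers (algebraMap R A ϖ)) K)
  rw [← finrank_fractionRing_tensor S (S ⊗[A] Ω[A⁄R]), e.finrank_eq]
  -- the rank over the field `K` is the rank of `Ω[A'⁄R]` at the prime below, i.e. the generic rank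
  have h1 : Module.rankAtStalk (K ⊗[A'] Ω[A'⁄R]) (⊥ : PrimeSpectrum K) = finrank K (K ⊗[A'] Ω[A'⁄R]) :=
    congrFun Module.rankAtStalk_eq_finrank_of_free ⊥
  rw [← h1, Module.rankAtStalk_baseChange]
  exact (Module.rankAtStalk_eq_of_le_of_finite_of_flat Ω[A'⁄R]
    (show (⊥ : PrimeSpectrum A') ≤ _ from bot_le)).symm

/-- **BLR 3.3/3 — `δ` is bounded when the generic fibre is smooth**, ring form with `Ω¹` of the
generic fibre locally free: if `A[1/ϖ]` is a domain, `Ω[A[1/ϖ]⁄R]` is finite projective (e.g.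
`X_K` smooth and integral) and `Ω[A⁄R]` is finitely generated, there is a bound `c`, depending
only on `X = Spec A`, with `δ(a) ≤ c` for every point `a` of `X` with values in a discrete
valuation ring `S` over `R` in which `ϖ` is a uniformizer. [folklore] -/
theorem exists_bound_neronDefect_of_projective [Module.Finite A Ω[A⁄R]] [IsDomain A']
    [Module.Projective A' Ω[A'⁄R]] :
    ∃ c : ℕ, ∀ (S : Type u) [CommRing S] [IsDomain S] [IsDiscreteValuationRing S] [Algebra R S]
      [Algebra A S] [IsScalarTower R A S], Irreducible (algebraMap R S ϖ) →
        neronDefect R A S ≤ c := by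
  haveI : Module.Finite A' Ω[A'⁄R] := by
    haveI : IsLocalizedModule (Submonoid.powers (algebraMap R A ϖ))
        (KaehlerDifferential.map R R A A') := inferInstance
    exact Module.Finite.of_isLocalizedModule (Submonoid.powers (algebraMap R A ϖ))
      (KaehlerDifferential.map R R A A')
  obtain ⟨n, hn⟩ := exists_pow_mem_fittingIdeal_of_isLocalization R ϖ A A'
    (fittingIdeal_eq_top_of_projective A' Ω[A'⁄R])
  obtain ⟨N, ω, hω⟩ := Module.Finite.exists_fin (R := A) (M := Ω[A⁄R])
  refine ⟨n * (N - Module.rankAtStalk Ω[A'⁄R] (⊥ : PrimeSpectrum A')), fun S _ _ _ _ _ _ hπ => ?_⟩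
  exact_mod_cast neronDefect_le_of_pow_mem_fittingIdeal R ϖ A S hπ hn
    (finrank_tensor_kaehler_eq_rankAtStalk R ϖ A A' S hπ.ne_zero) ω hω

end Literature.AlgebraicGeometry.Smoothening

end
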